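import Mathlib
import HarnessLib
import Literature.Analysis.FluidPDE.LagrangianLatticeCarrier
import Literature.Analysis.FluidPDE.PassiveVectorTensor
import Literature.Analysis.FluidPDE.PassiveVectorTensorPropagator  -- p647395 (taker g4): `Torus.IsPropagator` + `Torus.exists_isPropagator` — S0′ spec home
import Literature.Analysis.FluidPDE.StatisticalSolutionEnergyEq     -- `Torus.tailGradNormSq`, `Torus.integral_norm_sq_fourierTruncate_sub_le` (spectral tail)
import Literature.Analysis.FunctionSpaces.TorusTrigPoly
import Literature.Analysis.FunctionSpaces.TorusVectorParseval       -- `Torus.mFourierCoeff_congr_ae`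
import Summits.AnomalousDissipation.AnomalousDissipation.Theses.SolenoidalFractalHomogenisation
import Summits.AnomalousDissipation.AnomalousDissipation.Theorems.SolenoidalFractalHomogenisationLagrangianStepDefs
import Summits.AnomalousDissipation.AnomalousDissipation.Theorems.SolenoidalFractalHomogenisationLagrangianStepOneLevelDefs
import Summits.AnomalousDissipation.AnomalousDissipation.Theorems.SolenoidalFractalHomogenisationLagrangianRenormalisationStepExistsL
import Summits.AnomalousDissipation.AnomalousDissipation.Theorems.SolenoidalFractalHomogenisationLagrangianStepCellClauseCutsW
import Summits.AnomalousDissipation.AnomalousDissipation.Theorems.SolenoidalFractalHomogenisationLagrangianStepCellClauseCutsFamily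
import Summits.AnomalousDissipation.AnomalousDissipation.Theorems.SolenoidalFractalHomogenisationLagrangianStepOneLevelGlueLowerFamily
import Summits.AnomalousDissipation.AnomalousDissipation.Theorems.SolenoidalFractalHomogenisationRealisedQuasiStaticCellLawSectorReduction
import Summits.AnomalousDissipation.AnomalousDissipation.Theorems.SolenoidalFractalHomogenisationLagrangianStepWindowLedgerAbs   -- p645039 `window_ledger_abs`
import Summits.AnomalousDissipation.AnomalousDissipation.Theorems.SolenoidalFractalHomogenisationLagrangianStepOneLevelSplitApi    -- p648179 (brings the landed Defs p647662: `V2 datumLp cutLp …`)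
import Summits.AnomalousDissipation.AnomalousDissipation.Theorems.SolenoidalFractalHomogenisationLagrangianStepLedgerTrim         -- p649567 `trim_compare` (lead g2)
import Summits.AnomalousDissipation.AnomalousDissipation.Theorems.SolenoidalFractalHomogenisationLagrangianStepDatumTrim          -- g4: `isDatum_fourierTruncate`, `fourierTruncate_fourierTruncate`
import Summits.AnomalousDissipation.AnomalousDissipation.Theorems.SolenoidalFractalHomogenisationLagrangianStepClassTruncate      -- p650759 `inClass_fourierTruncate` (lead g2)
import Summits.AnomalousDissipation.AnomalousDissipation.Theorems.SolenoidalFractalHomogenisationLagrangianStepBaseT              -- `stub_baseT` (discharged by name)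
import Summits.AnomalousDissipation.AnomalousDissipation.Theorems.SolenoidalFractalHomogenisationLagrangianStepWindowPropagatorL  -- p648539 `windowPropagatorL` (S0′ discharged)

/-!
# K1L_D · `stub_oneLevelL_IW` v3-cut-2 (rev6) — the AMENDED composition: S0′ → S23″ → IW (tenure D24-11; lead F-lead-4/5/7 + spec P1–P4)

Planner ad-ideate-p4 g11 for the line lead `lead-k1l-onelevel-p1` g2 and the tenure planner ad-ideate-p1 g24.
Crux `LagrangianRenormalisationStepDesign` (stmt-AnomalousDissipation-27980), registry v2′ (`HOME/ad-ideate-p1/r24/rev18/onelevel_design_v2b.lean`,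
sha16 a758173cc9707753).  NOT a registry: `stub_oneLevelL_IW` stays WHOLE and the lead's; this file TYPES the amended cut and PROVES its composition.
Supersedes rev5 (33416b354cb4: three stubs S0′/S23′/S3d′ over `grid`/`cutLp`/`uSeq`): after the lead typed his side he found (F-lead-4) the last
window must be LONG (grid `gridL`: the last window absorbs the remainder, length in `[r, 2r)`), (F-lead-5) the datum must be TRIMMED to a band
`|ℓ| ≤ Lc` chosen INSIDE S23 (the class-`R` tail above `Lc` is paid in the composition, decay-relatively, by the spectral gap + `stub_baseT`), and
(F-lead-7) the slow cut `P_<` must GO (the uncut level-`(m+1)` state supplies its own (DD) allowance for the fast content): so S3d′ `stub_fastContentL`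
is deleted and the composition is TWO-piece.

## What is typed here (all over EXISTING tree declarations + the §1 defs-to-land)

* §1 DEFS TO LAND (`…Theorems.SolenoidalFractalHomogenisationLagrangianStepOneLevelSplitDefsL`, namespace `…LagrangianStep`; lander ad-k3l-bookkeeping-p1 g4):
  `gridL r t k := if k = 0 then 0 else if (k+1)·r ≤ t then k·r else t` (lead P3 verbatim: windows `[jr,(j+1)r)` while the NEXT one still fits, the last
  window ends at `t` and has length in `[r,2r)` when `r ≤ t`; degenerate windows `[t,t]` after it), and ONE propagated sequence
  `seqL U x r t : ℕ → V2`, `0 ↦ x`, `j+1 ↦ U 0 (gridL r t (j+1)) x` (so `u_j := seqL U^{m+1} x₁`, `v_j := seqL U^m x₁`; no cut, no `N`).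
* §1b API TO LAND (`…OneLevelSplitApiL`, namespace `…LagrangianStep.OneLevelSplit`): `gridL` order facts, `gridL_floor_succ : gridL r t (⌊t/r⌋₊+1) = t`,
  window lengths (`< 2r`; `empty ∨ ≥ r` under `r ≤ t`) for the lead, `seqL` unfoldings, `fourierTruncate_congr_ae`, `datumLp_fourierTruncate`
  (the trimmed datum class is `cutLp Lc` of the datum class), and the class-`R` spectral tail in `V2`:
  `4π²(Lc²+1)·‖x − cutLp Lc x‖² ≤ R·‖x‖²` (`norm_sub_cutLp_sq_le_of_inClass`; `Torus.integral_norm_sq_fourierTruncate_sub_le` + `tailGradNormSq_le`).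
* S0′  `stub_windowPropagatorL` — TEXT BYTE-UNCHANGED (discharged: `LagrangianStep.windowPropagatorL`, p648539; tenure (c′)).
* S23″ `stub_windowDefectL` — the lead's S23′ with EXACTLY the consented amendments: (P1) datum binders
  `∀ (w₁ : VF) (hw₁ : IsDatum w₁), InClass R w₁ → Torus.fourierTruncate Lc w₁ = w₁ →`; (P2) `∃ Lc : ℕ` right after `∀ m, mstar ≤ m →` with the
  TRIM EXPORT the composition consumes `(R:ℝ) ≤ Cτ·ρ^στ·Lc²·(1 − exp(−4π²·(kbar m·lo)))` (`∃ Cτ>0, ∃ στ>0` appended to the constant block; the last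
  factor is `stub_baseT`'s drop floor for the EFFECTIVE tensor, `NearIso` constant `kbar m·lo`) — my 17:12:34Z query-with-default replaces the lead's
  `N m² ≤ Lc²·cellVisc m`, which the glue cannot turn into a decay-relative budget without carrier bookkeeping; (P3) `gridL`; (F-lead-7) `seqL`, no cut.
  The `(DD)` and (iii) shapes of rev5 are unchanged (lead: consent in advance, 16:52:50Z).
* PROVED `oneLevelL_IW_of_piecesL : S0′-text → S23″-text → <the v2′ registry text of stub_oneLevelL_IW, VERBATIM>` (§4; to land as `…OneLevelSplitGlueL`):
  constants `C₁ := 2(3Cη + 12Cg) + 18·Cτ/(4π²) + 3`, `σ₁ := min (min ση σg) (στ/2)`; both propagators from S0′; the trimmed datum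
  `w₁ := P_{Lc} w₀` is a class-`R` band-limited datum (`isDatum_fourierTruncate`, `inClass_fourierTruncate`, `fourierTruncate_fourierTruncate`); the
  ledger `window_ledger_abs` runs on `x₁ := datumLp w₁` over the `gridL` of `t` read at `K := ⌊t/refresh⌋₊+1`; (P4) `trim_compare` with `T₀ := U^m_{0→t}`,
  `T₁ := U^{m+1}_{0→t}`, `x = x₁ + x₂`, `x₁ = cutLp Lc x ⊥ x₂` (`inner_cutLp_self`), `ε := min ε₁ 1`; the tail `‖x₂‖² ≤ (Cτ/4π²)·ρ^στ·drop_v` by the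
  export + the spectral gap + `stub_baseT`; `6‖x₂‖√D + 15‖x₂‖² ≤ (18Cτ/4π² + 3)·ρ^{στ/2}·D` by AM–GM with weight `ρ^{στ/2}` (`ρ > 0` from `N_pos`).

## Hazards handed to the lead (S23″ is THEIR text)
(h1) `u_0 := x₁` (forced by `h0 : u 0 = v 0`). (h2) degenerate windows `j ≥ K` (`gridL j = t`): `T_j = U t t` = σ-projection, `e_j = g_j = 0` works
(x₁ is σ: `isWeaklyDivFree_datumLp`). (h3) `(DD) ∀ y ∈ V2`: for `y ⊥ L²_σ` both sides vanish (`eq_zero_of_orth`). (h4) the export must hold for YOUR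
`Lc` for all `m ≥ mstar (R, E)`: it is your «trim ratio → 0 inside m⋆(R,E)» made a typed obligation — under the typed template hypotheses `a_m` is NOT
super-geometric, and `stub_baseT` is the only drop floor the composition has; if the export needs one more template hypothesis, name it BEFORE v3 registration.

`lean check` (farm): rc 0, sorries = 1 (S23″); `oneLevelL_IW_of_piecesL` is sorry-free and its conclusion is whitespace-identical to v2′'s `stub_oneLevelL_IW`
(script-diffed); `oneLevelL_IW_of_stubs := oneLevelL_IW_of_piecesL stub_windowPropagatorL stub_windowDefectL` is how registry v3 proves the stub.
-/

namespace Summit.AnomalousDissipation.AnomalousDissipation.Cruxes.LagrangianRenormalisationStepDesign.OneLevelSplit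

open Literature.Analysis Literature.Analysis.FluidPDE Literature.Analysis.FunctionSpaces
open MeasureTheory Set Filter ContinuousLinearMap
open scoped ENNReal NNReal InnerProductSpace

noncomputable section

set_option linter.dupNamespace false

open Summit.AnomalousDissipation.AnomalousDissipation.Theorems.SolenoidalFractalHomogenisation.LagrangianStep
open Summit.AnomalousDissipation.AnomalousDissipation.Theorems.SolenoidalFractalHomogenisation.LagrangianStep.OneLevelSplit
open Summit.AnomalousDissipation.AnomalousDissipation.Theorems.SolenoidalFractalHomogenisation.LagrangianRenormalisationStep
open Summit.AnomalousDissipation.AnomalousDissipation.Theorems.SolenoidalFractalHomogenisation.RealisedQuasiStaticCellLaw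
  (memLp_two_of_memSobolev_one_complexify)

/-! ## §1 DEFS TO LAND (verbatim into `…Theorems.SolenoidalFractalHomogenisationLagrangianStepOneLevelSplitDefsL`, namespace `…LagrangianStep`) -/

/-- The LONG-LAST-WINDOW grid at terminal time `t` for window length `r` (lead F-lead-4 / P3): `w_0 = 0`; for `k ≥ 1`, `w_k = k·r` as long as the
NEXT full window still fits (`(k+1)·r ≤ t`), else `w_k = t` — so the windows are `[jr,(j+1)r)` and the LAST one absorbs the remainder (length in
`[r, 2r)` when `r ≤ t`); the windows after it are degenerate `[t,t]`. -/
def gridL (r t : ℝ) (k : ℕ) : ℝ :=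
  if k = 0 then 0 else if ((k : ℝ) + 1) * r ≤ t then (k : ℝ) * r else t

/-- The propagated sequence of a datum class `x` along the `gridL` of `t` under a two-parameter propagator `U`: `0 ↦ x`, `j+1 ↦ U 0 w_{j+1} x`
(lead F-lead-7: the level-`(m+1)` sequence `u_j := seqL U^{m+1} x₁` is UNCUT; the exact sequence is `v_j := seqL U^m x₁`). -/
def seqL (U : ℝ → ℝ → (V2 →L[ℝ] V2)) (x : V2) (r t : ℝ) : ℕ → V2
  | 0 => x
  | (j + 1) => U 0 (gridL r t (j + 1)) x

/-! ## §1b API TO LAND (verbatim into `…Theorems.SolenoidalFractalHomogenisationLagrangianStepOneLevelSplitApiL`, namespace `…LagrangianStep.OneLevelSplit`) -/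

/-- `w_0 = 0`. -/
theorem gridL_zero (r t : ℝ) : gridL r t 0 = 0 := if_pos rfl

/-- A window index whose successor window fits: `w_k = k·r`. -/
theorem gridL_of_fits {r t : ℝ} {k : ℕ} (hk : k ≠ 0) (h : ((k : ℝ) + 1) * r ≤ t) : gridL r t k = (k : ℝ) * r := by
  rw [gridL, if_neg hk, if_pos h]

/-- A window index whose successor window does not fit: `w_k = t`. -/
theorem gridL_of_not_fits {r t : ℝ} {k : ℕ} (hk : k ≠ 0) (h : ¬ ((k : ℝ) + 1) * r ≤ t) : gridL r t k = t := by
  rw [gridL, if_neg hk, if_neg h]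

/-- `w_k ≤ t` (for `0 ≤ r`, `0 ≤ t`). -/
theorem gridL_le {r t : ℝ} (hr : 0 ≤ r) (ht : 0 ≤ t) (k : ℕ) : gridL r t k ≤ t := by
  unfold gridL
  split_ifs with h0 h1
  · exact ht
  · exact le_trans (by nlinarith) h1
  · exact le_rfl

/-- `0 ≤ w_k` (for `0 ≤ r`, `0 ≤ t`). -/
theorem gridL_nonneg {r t : ℝ} (hr : 0 ≤ r) (ht : 0 ≤ t) (k : ℕ) : 0 ≤ gridL r t k := by
  unfold gridL
  split_ifs
  · exact le_rfl
  · positivity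
  · exact ht

/-- The grid is monotone: `w_k ≤ w_{k+1}` (for `0 ≤ r`, `0 ≤ t`). -/
theorem gridL_mono {r t : ℝ} (hr : 0 ≤ r) (ht : 0 ≤ t) (k : ℕ) : gridL r t k ≤ gridL r t (k + 1) := by
  rcases Nat.eq_zero_or_pos k with rfl | hk
  · rw [gridL_zero]; exact gridL_nonneg hr ht _
  have hk0 : k ≠ 0 := Nat.pos_iff_ne_zero.1 hk
  by_cases h2 : (((k + 1 : ℕ) : ℝ) + 1) * r ≤ t
  · have h1 : ((k : ℝ) + 1) * r ≤ t := le_trans (by push_cast; nlinarith) h2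
    rw [gridL_of_fits hk0 h1, gridL_of_fits k.succ_ne_zero h2]; push_cast; nlinarith
  · rw [gridL_of_not_fits k.succ_ne_zero h2]
    exact gridL_le hr ht k

/-- The natural last index: `w_{⌊t/r⌋₊+1} = t` (for `0 < r`). -/
theorem gridL_floor_succ {r t : ℝ} (hr : 0 < r) : gridL r t (⌊t / r⌋₊ + 1) = t := by
  refine gridL_of_not_fits (Nat.succ_ne_zero _) (not_le.2 ?_)
  have h := Nat.lt_floor_add_one (t / r)
  rw [div_lt_iff₀ hr] at h
  push_cast at h ⊢
  nlinarith

/-- Every window is shorter than `2r` (for `0 < r`). -/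
theorem gridL_succ_sub_lt {r t : ℝ} (hr : 0 < r) (k : ℕ) : gridL r t (k + 1) - gridL r t k < 2 * r := by
  rcases Nat.eq_zero_or_pos k with rfl | hk
  · rw [gridL_zero, sub_zero]
    by_cases h : (((0 + 1 : ℕ) : ℝ) + 1) * r ≤ t
    · rw [gridL_of_fits (Nat.succ_ne_zero 0) h]; push_cast; linarith
    · rw [gridL_of_not_fits (Nat.succ_ne_zero 0) h]; push_cast at h; linarith
  have hk0 : k ≠ 0 := Nat.pos_iff_ne_zero.1 hk
  by_cases h1 : ((k : ℝ) + 1) * r ≤ t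
  · rw [gridL_of_fits hk0 h1]
    by_cases h2 : (((k + 1 : ℕ) : ℝ) + 1) * r ≤ t
    · rw [gridL_of_fits k.succ_ne_zero h2]; push_cast; linarith
    · rw [gridL_of_not_fits k.succ_ne_zero h2]; push_cast at h2; linarith
  · have h2 : ¬ (((k + 1 : ℕ) : ℝ) + 1) * r ≤ t := fun h2 => h1 (le_trans (by push_cast; nlinarith) h2)
    rw [gridL_of_not_fits hk0 h1, gridL_of_not_fits k.succ_ne_zero h2]; linarith

/-- When at least one full window fits (`r ≤ t`), every window is EMPTY or has length `≥ r` (the last one has length in `[r, 2r)`). -/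
theorem gridL_succ_sub_dichotomy {r t : ℝ} (hr : 0 < r) (hrt : r ≤ t) (k : ℕ) :
    gridL r t (k + 1) = gridL r t k ∨ r ≤ gridL r t (k + 1) - gridL r t k := by
  rcases Nat.eq_zero_or_pos k with rfl | hk
  · right
    rw [gridL_zero, sub_zero]
    by_cases h : (((0 + 1 : ℕ) : ℝ) + 1) * r ≤ t
    · rw [gridL_of_fits (Nat.succ_ne_zero 0) h]; push_cast; linarith
    · rw [gridL_of_not_fits (Nat.succ_ne_zero 0) h]; exact hrt
  have hk0 : k ≠ 0 := Nat.pos_iff_ne_zero.1 hk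
  by_cases h1 : ((k : ℝ) + 1) * r ≤ t
  · right
    rw [gridL_of_fits hk0 h1]
    by_cases h2 : (((k + 1 : ℕ) : ℝ) + 1) * r ≤ t
    · rw [gridL_of_fits k.succ_ne_zero h2]; push_cast; linarith
    · rw [gridL_of_not_fits k.succ_ne_zero h2]; linarith
  · left
    have h2 : ¬ (((k + 1 : ℕ) : ℝ) + 1) * r ≤ t := fun h2 => h1 (le_trans (by push_cast; nlinarith [hr.le]) h2)
    rw [gridL_of_not_fits hk0 h1, gridL_of_not_fits k.succ_ne_zero h2]

/-- `seqL U x r t 0 = x`. -/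
theorem seqL_zero (U : ℝ → ℝ → (V2 →L[ℝ] V2)) (x : V2) (r t : ℝ) : seqL U x r t 0 = x := rfl

/-- `seqL U x r t (j+1) = U 0 w_{j+1} x`. -/
theorem seqL_succ (U : ℝ → ℝ → (V2 →L[ℝ] V2)) (x : V2) (r t : ℝ) (j : ℕ) :
    seqL U x r t (j + 1) = U 0 (gridL r t (j + 1)) x := rfl

/-- The Fourier truncation only sees the a.e. class. -/
theorem fourierTruncate_congr_ae {u v : VF} (h : u =ᵐ[volume] v) (N : ℕ) :
    Torus.fourierTruncate N u = Torus.fourierTruncate N v := by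
  rw [Torus.fourierTruncate_eq, Torus.fourierTruncate_eq]
  simp_rw [Torus.mFourierCoeff_congr_ae (h.fun_comp EuclideanSpace.complexify)]

/-- **The trimmed datum's class is the cut of the datum's class**: `datumLp (P_N w₀) = cutLp N (datumLp w₀)` in `V2`. -/
theorem datumLp_fourierTruncate {w₀ : VF} (hw₀ : IsDatum w₀) (N : ℕ) (h₁ : IsDatum (Torus.fourierTruncate N w₀)) :
    datumLp (Torus.fourierTruncate N w₀) h₁ = cutLp N (datumLp w₀ hw₀) := by
  rw [datumLp, cutLp, MemLp.toLp_eq_toLp_iff]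
  rw [fourierTruncate_congr_ae (coeFn_datumLp w₀ hw₀) N]

/-- **The class-`R` spectral tail in `V2`**: `4π²(N²+1)·‖x − cutLp N x‖² ≤ R·‖x‖²` for the class `x` of a class-`R` datum (the modes with
`|k| > N` carry gradient weight `≥ 4π²(N²+1)`: `Torus.integral_norm_sq_fourierTruncate_sub_le` + `Torus.tailGradNormSq_le` + `InClass`). -/
theorem norm_sub_cutLp_sq_le_of_inClass {R : ℝ≥0} {w₀ : VF} (hw₀ : IsDatum w₀) (hR : InClass R w₀) (N : ℕ) :
    4 * Real.pi ^ 2 * ((N : ℝ) ^ 2 + 1) * ‖datumLp w₀ hw₀ - cutLp N (datumLp w₀ hw₀)‖ ^ 2 ≤ (R : ℝ) * ‖datumLp w₀ hw₀‖ ^ 2 := by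
  set x : V2 := datumLp w₀ hw₀ with hx
  have hw2 : MemLp w₀ 2 volume := memLp_two_of_memSobolev_one_complexify hw₀.1
  have hfin : (R : ℝ≥0∞) * ENNReal.ofReal (Torus.vectorL2Sq w₀) ≠ ⊤ := ENNReal.mul_ne_top ENNReal.coe_ne_top ENNReal.ofReal_ne_top
  have hgrad : Torus.eGradNormSq w₀ ≠ ⊤ := ne_top_of_le_ne_top hfin hR
  have htail : Torus.tailGradNormSq N w₀ ≠ ⊤ := ne_top_of_le_ne_top hgrad (Torus.tailGradNormSq_le N w₀)
  have h1 := Torus.integral_norm_sq_fourierTruncate_sub_le hw2 N htail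
  have h2 : (Torus.tailGradNormSq N w₀).toReal ≤ (R : ℝ) * Torus.vectorL2Sq w₀ := by
    have := ENNReal.toReal_mono hfin ((Torus.tailGradNormSq_le N w₀).trans hR)
    rwa [ENNReal.toReal_mul, ENNReal.coe_toReal, ENNReal.toReal_ofReal (show (0:ℝ) ≤ Torus.vectorL2Sq w₀ by unfold Torus.vectorL2Sq; positivity)] at this
  have h3 : ‖x - cutLp N x‖ ^ 2 = ∫ a, ‖Torus.fourierTruncate N w₀ a - w₀ a‖ ^ 2 := by
    rw [norm_sq_eq_integral]
    refine integral_congr_ae ?_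
    filter_upwards [Lp.coeFn_sub x (cutLp N x), coeFn_datumLp w₀ hw₀, coeFn_cutLp N x] with a ha hxa hca
    rw [ha, Pi.sub_apply, hca, hxa, fourierTruncate_congr_ae (coeFn_datumLp w₀ hw₀) N, norm_sub_rev]
  have hpos : 0 < 4 * Real.pi ^ 2 * ((N : ℝ) ^ 2 + 1) := by positivity
  rw [h3, norm_datumLp_sq, mul_comm]
  calc (∫ a, ‖Torus.fourierTruncate N w₀ a - w₀ a‖ ^ 2) * (4 * Real.pi ^ 2 * ((N : ℝ) ^ 2 + 1))
      ≤ (Torus.tailGradNormSq N w₀).toReal / (4 * Real.pi ^ 2 * ((N : ℝ) ^ 2 + 1)) * (4 * Real.pi ^ 2 * ((N : ℝ) ^ 2 + 1)) :=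
        mul_le_mul_of_nonneg_right h1 hpos.le
    _ = (Torus.tailGradNormSq N w₀).toReal := div_mul_cancel₀ _ hpos.ne'
    _ ≤ (R : ℝ) * Torus.vectorL2Sq w₀ := h2

/-! ## §3 The two stubs of the amended cut -/

/-- **S0′ (M+) window propagator** — TEXT BYTE-UNCHANGED from rev5 (discharged by `LagrangianStep.windowPropagatorL`, p648539).  For an `L`-permissible
regular carrier, every level `m` and every coercive constant tensor, the two-parameter solution family of the level-`m` linear problem exists as
contractions of `V2` with the `IsPropagator` properties. -/
theorem stub_windowPropagatorL : ∀ k (E : LatticeShear.LagrangianLatticeCarrier k), E.LPermissible → E.Regular →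
    ∀ (m : ℕ) (𝔸 : Torus.Visc4 (Fin 3)) (lo hi : ℝ), 0 < lo → Torus.NearIso 𝔸 lo hi →
      ∃ U : ℝ → ℝ → (V2 →L[ℝ] V2), Torus.IsPropagator 1 (E.partialSum m) 𝔸 U :=
  windowPropagatorL

/-- **S23″ (XL−; the lead's S1′∘S1″∘S2′∘S3′(e)∘S3e′ at the interface, AMENDED P1–P4 + F-lead-7) per-window defect decomposition of the UNCUT
level-`(m+1)` state on the long-last-window grid, for a TRIMMED datum.**  For `m ≥ m⋆(R,E)` the stub CHOOSES the trim level `Lc` and exports the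
trim budget `R ≤ Cτ ρ^στ Lc² (1 − e^{−4π² kbar_m lo})` (the composition's only use of `Lc` besides band-limitation); then for every band-limited
class-`R` datum `w₁` (`P_{Lc} w₁ = w₁`), with `T_j := U^m_{w_j → w_{j+1}}` on `gridL (refresh (m+1)) t` and `u_j := U^{m+1}_{0→w_j} x₁`:
`u_{j+1} = T_j u_j + e_j + g_j`, `e_j` dissipation-dominated at `η = Cη ρ^ση ≤ 1/8` against `T_j` and its adjoint, leftovers `g_j` summable with
`‖x₁‖·Σ‖g_j‖ ≤ Cg ρ^σg · (‖x₁‖² − ‖U^m_{0→t} x₁‖²)`. -/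
theorem stub_windowDefectL : ∀ k (W : Literature.Analysis.FluidPDE.LatticeShear.LatticeWord k) (M : ℝ) (hM : 0 < M) (c : ℝ), 0 < c →
    ∀ (Φ : ℝ → Torus.Visc4 (Fin 3) → Torus.Visc4 (Fin 3)) (lo hi Λ β σ C ν₀ K Cf νf Kf : ℝ),
      0 < lo → lo ≤ 1 → 1 ≤ hi → 1 < Λ → 0 ≤ β →
      0 < σ → 0 ≤ C → 0 < ν₀ → 0 < K → SlowVectorClauseF W M hM c Φ lo hi Λ β σ C ν₀ K →
      0 ≤ Cf → 0 < νf → 0 < Kf → CellEnergyClausesW W M hM c lo hi Λ β Cf νf Kf →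
      ∃ ν₁ > (0:ℝ), ∃ K₁ > (0:ℝ), ∃ Λ₀ : ℕ, ∃ θ₀ > (0:ℝ), ∃ Cη > (0:ℝ), ∃ ση > (0:ℝ), ∃ Cg > (0:ℝ), ∃ σg > (0:ℝ), ∃ Cτ > (0:ℝ), ∃ στ > (0:ℝ),
        ∀ E : Literature.Analysis.FluidPDE.LatticeShear.LagrangianLatticeCarrier k, E.design = W.stretch M hM → E.gain = c → E.nu0 ≤ ν₁ → K₁ ≤ E.K →
          E.LPermissible → E.Regular → (∀ m, Λ₀ * E.N m ≤ E.N (m + 1)) → (∀ m, E.N m ^ 2 ≤ E.N (m + 1)) →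
          (∀ m, E.cellVisc (m + 1) * ((E.N (m + 1) : ℝ) / E.N m) ^ (1 / 4 : ℝ) ≤ 1) →
          (∀ m, E.K * ((E.N (m + 1) : ℝ) / E.N m) ^ (1 / 4 : ℝ) ≤ ((E.N (m + 1) : ℝ) / E.N m) * E.cellVisc (m + 1)) →
          (∀ m, E.θ (m + 1) * ((E.N (m + 1) : ℝ) / E.N m) ^ (1 / 16 : ℝ) ≤ θ₀) →
          (∀ m, ((E.N (m + 1) : ℝ) / E.N m) ^ (1 / 16 : ℝ) * E.physPeriod (m + 1) ≤ E.refresh (m + 1)) →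
        ∀ R : ℝ≥0, ∃ mstar : ℕ, ∀ m, mstar ≤ m →
          ∃ Lc : ℕ,
          (R : ℝ) ≤ Cτ * ((E.N m : ℝ) / E.N (m + 1)) ^ στ * (Lc : ℝ) ^ 2 * (1 - Real.exp (-(4 * Real.pi ^ 2 * (E.kbar m * lo)))) ∧
          Cη * ((E.N m : ℝ) / E.N (m + 1)) ^ ση ≤ 1 / 8 ∧
          ∀ S : Torus.Visc4 (Fin 3), Torus.OddSmall S β → Torus.NearIso S lo hi →
            Torus.OddSmall (Φ (E.cellVisc (m + 1)) S) β → Torus.NearIso (Φ (E.cellVisc (m + 1)) S) lo hi →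
          ∀ (w₁ : VF) (hw₁ : IsDatum w₁), InClass R w₁ → Torus.fourierTruncate Lc w₁ = w₁ →
          ∀ Um Um1 : ℝ → ℝ → (V2 →L[ℝ] V2),
            Torus.IsPropagator 1 (E.partialSum m) (E.kbar m • renormStep (Φ (E.cellVisc (m + 1))) (E.gain / E.cellVisc (m + 1) ^ 2) S) Um →
            Torus.IsPropagator 1 (E.partialSum (m + 1)) (E.kbar (m + 1) • S) Um1 →
          ∀ t ∈ Ioo (1/2 : ℝ) 1,
            ∃ (e g : ℕ → V2) (G : ℝ),
              (∀ j, seqL Um1 (datumLp w₁ hw₁) (E.refresh (m + 1)) t (j + 1) =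
                  Um (gridL (E.refresh (m + 1)) t j) (gridL (E.refresh (m + 1)) t (j + 1))
                    (seqL Um1 (datumLp w₁ hw₁) (E.refresh (m + 1)) t j) + e j + g j) ∧
              (∀ j (y : V2), |⟪y, e j⟫_ℝ| ≤
                  (Cη * ((E.N m : ℝ) / E.N (m + 1)) ^ ση) *
                    Real.sqrt (‖seqL Um1 (datumLp w₁ hw₁) (E.refresh (m + 1)) t j‖ ^ 2 -
                      ‖Um (gridL (E.refresh (m + 1)) t j) (gridL (E.refresh (m + 1)) t (j + 1))
                        (seqL Um1 (datumLp w₁ hw₁) (E.refresh (m + 1)) t j)‖ ^ 2) *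
                    Real.sqrt (‖y‖ ^ 2 -
                      ‖ContinuousLinearMap.adjoint (Um (gridL (E.refresh (m + 1)) t j) (gridL (E.refresh (m + 1)) t (j + 1))) y‖ ^ 2)) ∧
              0 ≤ G ∧ (∀ K', ∑ j ∈ Finset.range K', ‖g j‖ ≤ G) ∧ G ≤ ‖datumLp w₁ hw₁‖ ∧
              ‖datumLp w₁ hw₁‖ * G ≤
                Cg * ((E.N m : ℝ) / E.N (m + 1)) ^ σg * (‖datumLp w₁ hw₁‖ ^ 2 - ‖Um 0 t (datumLp w₁ hw₁)‖ ^ 2) := by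
  sorry

/-! ## §4 The composition in IMPLICATION form — `S0′-text → S23″-text → (v2′ text of stub_oneLevelL_IW, VERBATIM)`, sorry-free
(to land verbatim as `…Theorems.SolenoidalFractalHomogenisationLagrangianStepOneLevelSplitGlueL`, theorem `oneLevelL_IW_of_piecesL`). -/

/-- **The amended one-level cut composes (v3-cut-2).**  `S0′ → S23″ → stub_oneLevelL_IW` (v2′ text verbatim): both propagators from S0′; the datum is
trimmed to `w₁ := P_{Lc} w₀` (again a class-`R` datum, band-limited); the energy ledger `window_ledger_abs` runs on `x₁ := datumLp w₁` along the
`gridL` of `t`; the trimmed-off tail `x₂ := x − x₁ ⊥ x₁` is restored by `trim_compare`, its budget `‖x₂‖² ≤ (Cτ/4π²)·ρ^στ·drop_v` coming from the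
S23″ export, the spectral gap and `stub_baseT`. -/
theorem oneLevelL_IW_of_piecesL :
    (∀ k (E : LatticeShear.LagrangianLatticeCarrier k), E.LPermissible → E.Regular →
    ∀ (m : ℕ) (𝔸 : Torus.Visc4 (Fin 3)) (lo hi : ℝ), 0 < lo → Torus.NearIso 𝔸 lo hi →
      ∃ U : ℝ → ℝ → (V2 →L[ℝ] V2), Torus.IsPropagator 1 (E.partialSum m) 𝔸 U) →
    (∀ k (W : Literature.Analysis.FluidPDE.LatticeShear.LatticeWord k) (M : ℝ) (hM : 0 < M) (c : ℝ), 0 < c →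
    ∀ (Φ : ℝ → Torus.Visc4 (Fin 3) → Torus.Visc4 (Fin 3)) (lo hi Λ β σ C ν₀ K Cf νf Kf : ℝ),
      0 < lo → lo ≤ 1 → 1 ≤ hi → 1 < Λ → 0 ≤ β →
      0 < σ → 0 ≤ C → 0 < ν₀ → 0 < K → SlowVectorClauseF W M hM c Φ lo hi Λ β σ C ν₀ K →
      0 ≤ Cf → 0 < νf → 0 < Kf → CellEnergyClausesW W M hM c lo hi Λ β Cf νf Kf →
      ∃ ν₁ > (0:ℝ), ∃ K₁ > (0:ℝ), ∃ Λ₀ : ℕ, ∃ θ₀ > (0:ℝ), ∃ Cη > (0:ℝ), ∃ ση > (0:ℝ), ∃ Cg > (0:ℝ), ∃ σg > (0:ℝ), ∃ Cτ > (0:ℝ), ∃ στ > (0:ℝ),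
        ∀ E : Literature.Analysis.FluidPDE.LatticeShear.LagrangianLatticeCarrier k, E.design = W.stretch M hM → E.gain = c → E.nu0 ≤ ν₁ → K₁ ≤ E.K →
          E.LPermissible → E.Regular → (∀ m, Λ₀ * E.N m ≤ E.N (m + 1)) → (∀ m, E.N m ^ 2 ≤ E.N (m + 1)) →
          (∀ m, E.cellVisc (m + 1) * ((E.N (m + 1) : ℝ) / E.N m) ^ (1 / 4 : ℝ) ≤ 1) →
          (∀ m, E.K * ((E.N (m + 1) : ℝ) / E.N m) ^ (1 / 4 : ℝ) ≤ ((E.N (m + 1) : ℝ) / E.N m) * E.cellVisc (m + 1)) →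
          (∀ m, E.θ (m + 1) * ((E.N (m + 1) : ℝ) / E.N m) ^ (1 / 16 : ℝ) ≤ θ₀) →
          (∀ m, ((E.N (m + 1) : ℝ) / E.N m) ^ (1 / 16 : ℝ) * E.physPeriod (m + 1) ≤ E.refresh (m + 1)) →
        ∀ R : ℝ≥0, ∃ mstar : ℕ, ∀ m, mstar ≤ m →
          ∃ Lc : ℕ,
          (R : ℝ) ≤ Cτ * ((E.N m : ℝ) / E.N (m + 1)) ^ στ * (Lc : ℝ) ^ 2 * (1 - Real.exp (-(4 * Real.pi ^ 2 * (E.kbar m * lo)))) ∧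
          Cη * ((E.N m : ℝ) / E.N (m + 1)) ^ ση ≤ 1 / 8 ∧
          ∀ S : Torus.Visc4 (Fin 3), Torus.OddSmall S β → Torus.NearIso S lo hi →
            Torus.OddSmall (Φ (E.cellVisc (m + 1)) S) β → Torus.NearIso (Φ (E.cellVisc (m + 1)) S) lo hi →
          ∀ (w₁ : VF) (hw₁ : IsDatum w₁), InClass R w₁ → Torus.fourierTruncate Lc w₁ = w₁ →
          ∀ Um Um1 : ℝ → ℝ → (V2 →L[ℝ] V2),
            Torus.IsPropagator 1 (E.partialSum m) (E.kbar m • renormStep (Φ (E.cellVisc (m + 1))) (E.gain / E.cellVisc (m + 1) ^ 2) S) Um →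
            Torus.IsPropagator 1 (E.partialSum (m + 1)) (E.kbar (m + 1) • S) Um1 →
          ∀ t ∈ Ioo (1/2 : ℝ) 1,
            ∃ (e g : ℕ → V2) (G : ℝ),
              (∀ j, seqL Um1 (datumLp w₁ hw₁) (E.refresh (m + 1)) t (j + 1) =
                  Um (gridL (E.refresh (m + 1)) t j) (gridL (E.refresh (m + 1)) t (j + 1))
                    (seqL Um1 (datumLp w₁ hw₁) (E.refresh (m + 1)) t j) + e j + g j) ∧
              (∀ j (y : V2), |⟪y, e j⟫_ℝ| ≤
                  (Cη * ((E.N m : ℝ) / E.N (m + 1)) ^ ση) *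
                    Real.sqrt (‖seqL Um1 (datumLp w₁ hw₁) (E.refresh (m + 1)) t j‖ ^ 2 -
                      ‖Um (gridL (E.refresh (m + 1)) t j) (gridL (E.refresh (m + 1)) t (j + 1))
                        (seqL Um1 (datumLp w₁ hw₁) (E.refresh (m + 1)) t j)‖ ^ 2) *
                    Real.sqrt (‖y‖ ^ 2 -
                      ‖ContinuousLinearMap.adjoint (Um (gridL (E.refresh (m + 1)) t j) (gridL (E.refresh (m + 1)) t (j + 1))) y‖ ^ 2)) ∧
              0 ≤ G ∧ (∀ K', ∑ j ∈ Finset.range K', ‖g j‖ ≤ G) ∧ G ≤ ‖datumLp w₁ hw₁‖ ∧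
              ‖datumLp w₁ hw₁‖ * G ≤
                Cg * ((E.N m : ℝ) / E.N (m + 1)) ^ σg * (‖datumLp w₁ hw₁‖ ^ 2 - ‖Um 0 t (datumLp w₁ hw₁)‖ ^ 2)) →
    ∀ k (W : Literature.Analysis.FluidPDE.LatticeShear.LatticeWord k) (M : ℝ) (hM : 0 < M) (c : ℝ), 0 < c →
    ∀ (Φ : ℝ → Torus.Visc4 (Fin 3) → Torus.Visc4 (Fin 3)) (lo hi Λ β σ C ν₀ K Cf νf Kf : ℝ),
      0 < lo → lo ≤ 1 → 1 ≤ hi → 1 < Λ → 0 ≤ β →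
      0 < σ → 0 ≤ C → 0 < ν₀ → 0 < K → SlowVectorClauseF W M hM c Φ lo hi Λ β σ C ν₀ K →
      0 ≤ Cf → 0 < νf → 0 < Kf → CellEnergyClausesW W M hM c lo hi Λ β Cf νf Kf →
      ∃ ν₁ > (0:ℝ), ∃ K₁ > (0:ℝ), ∃ Λ₀ : ℕ, ∃ θ₀ > (0:ℝ), ∃ C₁ > (0:ℝ), ∃ σ₁ > (0:ℝ),
        ∀ E : Literature.Analysis.FluidPDE.LatticeShear.LagrangianLatticeCarrier k, E.design = W.stretch M hM → E.gain = c → E.nu0 = ν₁ → E.K = K₁ → E.LPermissible → E.Regular → (∀ m, Λ₀ * E.N m ≤ E.N (m + 1)) → (∀ m, E.N m ^ 2 ≤ E.N (m + 1)) → (∀ m, E.cellVisc (m + 1) * ((E.N (m + 1) : ℝ) / E.N m) ^ (1 / 4 : ℝ) ≤ 1) → (∀ m, E.K * ((E.N (m + 1) : ℝ) / E.N m) ^ (1 / 4 : ℝ) ≤ ((E.N (m + 1) : ℝ) / E.N m) * E.cellVisc (m + 1)) → (∀ m, E.θ (m + 1) * ((E.N (m + 1) : ℝ) / E.N m) ^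 (1 / 16 : ℝ) ≤ θ₀) → (∀ m, ((E.N (m + 1) : ℝ) / E.N m) ^ (1 / 16 : ℝ) * E.physPeriod (m + 1) ≤ E.refresh (m + 1)) →
        ∀ R : ℝ≥0, ∃ mstar : ℕ, ∀ m, mstar ≤ m →
          ∀ S : Torus.Visc4 (Fin 3), Torus.OddSmall S β → Torus.NearIso S lo hi →
            Torus.OddSmall (Φ (E.cellVisc (m + 1)) S) β → Torus.NearIso (Φ (E.cellVisc (m + 1)) S) lo hi →
          ∀ (w₀ : VF), IsDatum w₀ → InClass R w₀ →
          ∀ u v : ℝ → VF, TSol E (m + 1) (E.kbar (m + 1) • S) w₀ u →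
            TSol E m (E.kbar m • renormStep (Φ (E.cellVisc (m + 1))) (E.gain / E.cellVisc (m + 1) ^ 2) S) w₀ v →
            ∀ᵐ t ∂(volume.restrict (Ioo (1/2 : ℝ) 1)),
              (1 - C₁ * ((E.N m : ℝ) / E.N (m + 1)) ^ σ₁) * drop w₀ v t ≤ drop w₀ u t := by
  intro hS0 hS23 k W M hM c hc Φ lo hi Λ β σ C ν₀ K Cf νf Kf hlo hlo1 hhi hΛ hβ hσ hC hν₀ hK hV hCf hνf hKf hF
  obtain ⟨ν₁, hν₁, K₁, hK₁, Λ₀, θ₀, hθ₀, Cη, hCη, ση, hση, Cg, hCg, σg, hσg, Cτ, hCτ, στ, hστ, hD⟩ :=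
    hS23 k W M hM c hc Φ lo hi Λ β σ C ν₀ K Cf νf Kf hlo hlo1 hhi hΛ hβ hσ hC hν₀ hK hV hCf hνf hKf hF
  refine ⟨ν₁, hν₁, K₁, hK₁, Λ₀, θ₀, hθ₀, 2 * (3 * Cη + 12 * Cg) + (18 * (Cτ / (4 * Real.pi ^ 2)) + 3), by positivity,
    min (min ση σg) (στ / 2), lt_min (lt_min hση hσg) (half_pos hστ), ?_⟩
  intro E hdes hgain hnu0 hKE hLP hReg hT2 hN2 hT3a hT3b hT4 hT5 R
  obtain ⟨m₁, hm₁⟩ := hD E hdes hgain hnu0.le hKE.symm.le hLP hReg hT2 hN2 hT3a hT3b hT4 hT5 R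
  refine ⟨m₁, fun m hm S hS₁ hS₂ hS₃ hS₄ w₀ hw₀ hR u v hu hv => ?_⟩
  obtain ⟨Lc, htrim, hη8, hDm⟩ := hm₁ m hm
  -- the two propagators from S0′
  have hgain0 : 0 ≤ E.gain := hgain ▸ hc.le
  have h𝔸v : Torus.NearIso (E.kbar m • renormStep (Φ (E.cellVisc (m + 1))) (E.gain / E.cellVisc (m + 1) ^ 2) S)
      (E.kbar m * lo) (E.kbar m * hi) :=
    (nearIso_renormStep (div_nonneg hgain0 (sq_nonneg _)) hS₂ hS₄).smul (E.kbar_pos m).le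
  have h𝔸u : Torus.NearIso (E.kbar (m + 1) • S) (E.kbar (m + 1) * lo) (E.kbar (m + 1) * hi) :=
    hS₂.smul (E.kbar_pos (m + 1)).le
  obtain ⟨Um, hUm⟩ := hS0 k E hLP hReg m _ _ _ (mul_pos (E.kbar_pos m) hlo) h𝔸v
  obtain ⟨Um1, hUm1⟩ := hS0 k E hLP hReg (m + 1) _ _ _ (mul_pos (E.kbar_pos (m + 1)) hlo) h𝔸u
  -- the trimmed datum `w₁ := P_{Lc} w₀`: again a class-`R` datum, band-limited
  have hw₀2 : MemLp w₀ 2 volume := memLp_two_of_memSobolev_one_complexify hw₀.1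
  have hw₁ : IsDatum (Torus.fourierTruncate Lc w₀) := isDatum_fourierTruncate hw₀ Lc
  have hR₁ : InClass R (Torus.fourierTruncate Lc w₀) := inClass_fourierTruncate hw₀2 hR Lc
  have hband : Torus.fourierTruncate Lc (Torus.fourierTruncate Lc w₀) = Torus.fourierTruncate Lc w₀ :=
    fourierTruncate_fourierTruncate (hw₀2.integrable one_le_two) Lc
  -- a.e. representation of `u t` and `v t` through the propagators, and the `stub_baseT` floor of `drop_v`
  have hrepu := hUm1.repr 0 le_rfl zero_lt_one w₀ hw₀2 hw₀.2.2 u (by simpa only [TSol, sub_zero, zero_add] using hu)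
  have hrepv := hUm.repr 0 le_rfl zero_lt_one w₀ hw₀2 hw₀.2.2 v (by simpa only [TSol, sub_zero, zero_add] using hv)
  have hbase := stub_baseT k E hLP hReg m _ _ _ (mul_pos (E.kbar_pos m) hlo) h𝔸v w₀ v hw₀ hv
  have hsub : Ioo (1/2 : ℝ) 1 ⊆ Ioo 0 (1 - 0) := by
    rw [sub_zero]; exact Ioo_subset_Ioo (by norm_num) le_rfl
  filter_upwards [ae_restrict_of_ae_restrict_of_subset hsub hrepu, ae_restrict_of_ae_restrict_of_subset hsub hrepv, hbase,
    ae_restrict_mem measurableSet_Ioo] with t hu1 hv1 hbt ht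
  obtain ⟨hut, hute⟩ := hu1
  obtain ⟨hvt, hvte⟩ := hv1
  rw [zero_add] at hute hvte
  have ht0 : 0 ≤ t := by linarith [ht.1]
  have ht1 : t ≤ 1 := ht.2.le
  have hr : 0 < E.refresh (m + 1) := E.refresh_pos (m + 1)
  -- names: the datum class `x`, its trimmed part `x₁ = cutLp Lc x`, the tail `x₂ := x - x₁`
  set x : V2 := datumLp w₀ hw₀ with hx_def
  set x₁ : V2 := datumLp (Torus.fourierTruncate Lc w₀) hw₁ with hx₁_def
  have hx₁ : x₁ = cutLp Lc x := datumLp_fourierTruncate hw₀ Lc hw₁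
  -- energies through the propagators
  have hEu : ∫ a, ‖u t a‖ ^ 2 = ‖Um1 0 t x‖ ^ 2 := by
    rw [← norm_toLp_sq hut, hute]; rfl
  have hEv : ∫ a, ‖v t a‖ ^ 2 = ‖Um 0 t x‖ ^ 2 := by
    rw [← norm_toLp_sq hvt, hvte]; rfl
  have hE0 : Torus.vectorL2Sq w₀ = ‖x‖ ^ 2 := (norm_datumLp_sq w₀ hw₀).symm
  -- the per-window decomposition (S23″) for the trimmed datum
  obtain ⟨e, g, G, hdec, hDD, hG0, hGsum, hGle, hGpay⟩ :=
    hDm S hS₁ hS₂ hS₃ hS₄ (Torus.fourierTruncate Lc w₀) hw₁ hR₁ hband Um Um1 hUm hUm1 t ht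
  -- the ledger on the `gridL` of `t`, for `x₁`
  set ρ : ℝ := (E.N m : ℝ) / E.N (m + 1) with hρ_def
  have hρ0 : 0 ≤ ρ := rho_nonneg _ _
  have hρ1 : ρ ≤ 1 := rho_le_one (hN2 m)
  have hρpos : 0 < ρ := div_pos (Nat.cast_pos.2 (E.N_pos m)) (Nat.cast_pos.2 (E.N_pos (m + 1)))
  have hη0 : 0 ≤ Cη * ρ ^ ση := mul_nonneg hCη.le (Real.rpow_nonneg hρ0 _)
  have hvs : ∀ j, seqL Um x₁ (E.refresh (m + 1)) t (j + 1) =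
      Um (gridL (E.refresh (m + 1)) t j) (gridL (E.refresh (m + 1)) t (j + 1)) (seqL Um x₁ (E.refresh (m + 1)) t j) := by
    intro j
    cases j with
    | zero => rw [seqL_succ, seqL_zero, gridL_zero]
    | succ j =>
      rw [seqL_succ, seqL_succ,
        hUm.comp 0 _ _ le_rfl (gridL_nonneg hr.le ht0 _) (gridL_mono hr.le ht0 _) ((gridL_le hr.le ht0 _).trans ht1)]
  have hL := window_ledger_abs
    (fun j => Um (gridL (E.refresh (m + 1)) t j) (gridL (E.refresh (m + 1)) t (j + 1)))
    (fun j y => hUm.norm_le _ _ y)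
    (seqL Um1 x₁ (E.refresh (m + 1)) t) (seqL Um x₁ (E.refresh (m + 1)) t) e g (fun j => ‖g j‖) (Cη * ρ ^ ση) hη0 hη8
    (fun j => norm_nonneg _) rfl hvs hdec (fun j => le_rfl) hDD
    (⌊t / E.refresh (m + 1)⌋₊ + 1)
  have hsumG : ∑ j ∈ Finset.range (⌊t / E.refresh (m + 1)⌋₊ + 1), ‖g j‖ ≤ G := hGsum _
  have hsum0 : 0 ≤ ∑ j ∈ Finset.range (⌊t / E.refresh (m + 1)⌋₊ + 1), ‖g j‖ := Finset.sum_nonneg fun j _ => norm_nonneg _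
  -- read the ledger at `K = ⌊t/refresh⌋₊ + 1`, where `gridL K = t`
  have hKt : gridL (E.refresh (m + 1)) t (⌊t / E.refresh (m + 1)⌋₊ + 1) = t := gridL_floor_succ hr
  have huK : seqL Um1 x₁ (E.refresh (m + 1)) t (⌊t / E.refresh (m + 1)⌋₊ + 1) = Um1 0 t x₁ := by rw [seqL_succ, hKt]
  have hvK : seqL Um x₁ (E.refresh (m + 1)) t (⌊t / E.refresh (m + 1)⌋₊ + 1) = Um 0 t x₁ := by rw [seqL_succ, hKt]
  have hv0 : seqL Um x₁ (E.refresh (m + 1)) t 0 = x₁ := rfl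
  rw [huK, hvK, hv0] at hL
  -- the trimmed ledger: `‖U¹ x₁‖² ≤ ‖U⁰ x₁‖² + ε₁ D₁`
  set D₁ : ℝ := ‖x₁‖ ^ 2 - ‖Um 0 t x₁‖ ^ 2 with hD₁_def
  have hv₁le : ‖Um 0 t x₁‖ ≤ ‖x₁‖ := hUm.norm_le _ _ _
  have hD₁0 : 0 ≤ D₁ := by rw [hD₁_def]; exact sub_nonneg.2 (pow_le_pow_left₀ (norm_nonneg _) hv₁le 2)
  have hGG : G * G ≤ ‖x₁‖ * G := mul_le_mul_of_nonneg_right hGle hG0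
  have hjunk : 6 * (‖x₁‖ + ∑ j ∈ Finset.range (⌊t / E.refresh (m + 1)⌋₊ + 1), ‖g j‖) *
      ∑ j ∈ Finset.range (⌊t / E.refresh (m + 1)⌋₊ + 1), ‖g j‖ ≤ 12 * (Cg * ρ ^ σg * D₁) := by
    calc 6 * (‖x₁‖ + ∑ j ∈ Finset.range (⌊t / E.refresh (m + 1)⌋₊ + 1), ‖g j‖) *
          ∑ j ∈ Finset.range (⌊t / E.refresh (m + 1)⌋₊ + 1), ‖g j‖
        ≤ 6 * ((‖x₁‖ + G) * G) := by
          rw [mul_assoc]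
          exact mul_le_mul_of_nonneg_left (mul_le_mul (by linarith only [hsumG]) hsumG hsum0 (by positivity)) (by norm_num)
      _ = 6 * (‖x₁‖ * G) + 6 * (G * G) := by ring
      _ ≤ 6 * (‖x₁‖ * G) + 6 * (‖x₁‖ * G) := by linarith only [hGG]
      _ = 12 * (‖x₁‖ * G) := by ring
      _ ≤ 12 * (Cg * ρ ^ σg * D₁) := by linarith only [hGpay]
  set ε₁ : ℝ := 3 * (Cη * ρ ^ ση) + 12 * (Cg * ρ ^ σg) with hε₁_def
  have hε₁0 : 0 ≤ ε₁ := by positivity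
  have hmain₁ : ‖Um1 0 t x₁‖ ^ 2 ≤ ‖Um 0 t x₁‖ ^ 2 + ε₁ * D₁ := by
    rw [hε₁_def, hD₁_def]; rw [hD₁_def] at hjunk; linarith only [hL, hjunk]
  -- (P4) trim: restore the tail `x₂ := x - x₁ ⊥ x₁` with `trim_compare`, `ε := min ε₁ 1`
  have horth : ⟪x₁, x - x₁⟫_ℝ = 0 := by
    rw [inner_sub_right, real_inner_self_eq_norm_sq, hx₁, real_inner_comm, inner_cutLp_self, sub_self]
  have hledger : ‖Um1 0 t x₁‖ ^ 2 ≤ ‖Um 0 t x₁‖ ^ 2 + min ε₁ 1 * D₁ := by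
    rcases min_cases ε₁ 1 with ⟨h, _⟩ | ⟨h, _⟩
    · rw [h]; exact hmain₁
    · rw [h, one_mul, hD₁_def]
      linarith only [pow_le_pow_left₀ (norm_nonneg _) (hUm1.norm_le 0 t x₁) 2]
  have htc := trim_compare (Um 0 t) (Um1 0 t) (fun y => hUm.norm_le _ _ y) (fun y => hUm1.norm_le _ _ y) x₁ (x - x₁) horth
    (le_min hε₁0 zero_le_one) (min_le_right _ _) hledger
  rw [add_sub_cancel] at htc
  -- the tail budget: `4π² ‖x₂‖² ≤ Cτ ρ^στ · D` from the export, the spectral gap and the `stub_baseT` floor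
  set D : ℝ := ‖x‖ ^ 2 - ‖Um 0 t x‖ ^ 2 with hD_def
  have hvle : ‖Um 0 t x‖ ≤ ‖x‖ := hUm.norm_le _ _ _
  have hD0 : 0 ≤ D := by rw [hD_def]; exact sub_nonneg.2 (pow_le_pow_left₀ (norm_nonneg _) hvle 2)
  set B : ℝ := 1 - Real.exp (-(4 * Real.pi ^ 2 * (E.kbar m * lo))) with hB_def
  have hBD : B * ‖x‖ ^ 2 ≤ D := by
    have := hbt; simp only [drop] at this; rw [hEv, hE0] at this; exact this
  set A : ℝ := ‖x - x₁‖ ^ 2 with hA_def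
  have hgap : 4 * Real.pi ^ 2 * ((Lc : ℝ) ^ 2 + 1) * A ≤ (R : ℝ) * ‖x‖ ^ 2 := by
    rw [hA_def, hx₁]; exact norm_sub_cutLp_sq_le_of_inClass hw₀ hR Lc
  have hcoef0 : 0 ≤ Cτ * ρ ^ στ * (Lc : ℝ) ^ 2 := by positivity
  have hA : 4 * Real.pi ^ 2 * A ≤ Cτ * ρ ^ στ * D := by
    have hL1 : 0 < (Lc : ℝ) ^ 2 + 1 := by positivity
    have h1 : ((Lc : ℝ) ^ 2 + 1) * (4 * Real.pi ^ 2 * A) ≤ ((Lc : ℝ) ^ 2 + 1) * (Cτ * ρ ^ στ * D) :=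
      calc ((Lc : ℝ) ^ 2 + 1) * (4 * Real.pi ^ 2 * A) = 4 * Real.pi ^ 2 * ((Lc : ℝ) ^ 2 + 1) * A := by ring
        _ ≤ (R : ℝ) * ‖x‖ ^ 2 := hgap
        _ ≤ Cτ * ρ ^ στ * (Lc : ℝ) ^ 2 * B * ‖x‖ ^ 2 := mul_le_mul_of_nonneg_right htrim (sq_nonneg _)
        _ = Cτ * ρ ^ στ * (Lc : ℝ) ^ 2 * (B * ‖x‖ ^ 2) := by ring
        _ ≤ Cτ * ρ ^ στ * (Lc : ℝ) ^ 2 * D := mul_le_mul_of_nonneg_left hBD hcoef0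
        _ ≤ Cτ * ρ ^ στ * ((Lc : ℝ) ^ 2 + 1) * D :=
          mul_le_mul_of_nonneg_right (mul_le_mul_of_nonneg_left (by linarith) (by positivity)) hD0
        _ = ((Lc : ℝ) ^ 2 + 1) * (Cτ * ρ ^ στ * D) := by ring
    exact le_of_mul_le_mul_left h1 hL1
  -- AM–GM with weight `δ := ρ^{στ/2}`: `6‖x₂‖√D ≤ 3(A/δ + δD)`, and `A ≤ Cτ' δ² D`
  set Cτ' : ℝ := Cτ / (4 * Real.pi ^ 2) with hCτ'_def
  have hCτ'0 : 0 ≤ Cτ' := by positivity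
  set δ : ℝ := ρ ^ (στ / 2) with hδ_def
  have hδ : 0 < δ := Real.rpow_pos_of_pos hρpos _
  have hδ1 : δ ≤ 1 := Real.rpow_le_one hρ0 hρ1 (half_pos hστ).le
  have hδδ : ρ ^ στ = δ * δ := by rw [hδ_def, ← Real.rpow_add hρpos, add_halves]
  have hA' : A ≤ Cτ' * (δ * δ) * D := by
    rw [hCτ'_def, ← hδδ]
    have hπ : 0 < 4 * Real.pi ^ 2 := by positivity
    rw [div_mul_eq_mul_div, div_mul_eq_mul_div, le_div_iff₀ hπ]
    linarith only [hA]
  have hsq : Real.sqrt D ^ 2 = D := Real.sq_sqrt hD0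
  have hamgm : 6 * ‖x - x₁‖ * Real.sqrt D * δ ≤ 3 * A + 3 * (δ * δ) * D := by
    have hid : 3 * ‖x - x₁‖ ^ 2 + 3 * (δ * δ) * Real.sqrt D ^ 2 - 6 * ‖x - x₁‖ * Real.sqrt D * δ =
        3 * (‖x - x₁‖ - δ * Real.sqrt D) ^ 2 := by ring
    rw [hsq] at hid
    have h0 : 0 ≤ 3 * (‖x - x₁‖ - δ * Real.sqrt D) ^ 2 := by positivity
    rw [hA_def]; linarith only [hid, h0]
  -- `6‖x₂‖√D ≤ 3 Cτ' δ D + 3 δ D` (divide the AM–GM by δ > 0 after inserting `A ≤ Cτ' δ² D`)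
  have hcross : 6 * ‖x - x₁‖ * Real.sqrt D ≤ (3 * Cτ' + 3) * δ * D := by
    have h1 : 6 * ‖x - x₁‖ * Real.sqrt D * δ ≤ ((3 * Cτ' + 3) * δ * D) * δ := by
      have : 3 * A ≤ 3 * (Cτ' * (δ * δ) * D) := by linarith [hA']
      have hre : ((3 * Cτ' + 3) * δ * D) * δ = 3 * (Cτ' * (δ * δ) * D) + 3 * (δ * δ) * D := by ring
      rw [hre]; linarith only [hamgm, this]
    exact le_of_mul_le_mul_right h1 hδ
  have htail15 : 15 * ‖x - x₁‖ ^ 2 ≤ 15 * Cτ' * δ * D := by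
    have : A ≤ Cτ' * δ * D := by
      calc A ≤ Cτ' * (δ * δ) * D := hA'
        _ ≤ Cτ' * (δ * 1) * D := by
          exact mul_le_mul_of_nonneg_right (mul_le_mul_of_nonneg_left (mul_le_mul_of_nonneg_left hδ1 hδ.le) hCτ'0) hD0
        _ = Cτ' * δ * D := by ring
    rw [← hA_def]; linarith only [this]
  -- exponents: every rate is at least `σ₁ := min (min ση σg) (στ/2)`
  have hρpow : ∀ {s : ℝ}, min (min ση σg) (στ / 2) ≤ s → ρ ^ s ≤ ρ ^ min (min ση σg) (στ / 2) := fun hs =>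
    Real.rpow_le_rpow_of_exponent_ge' hρ0 hρ1 (lt_min (lt_min hση hσg) (half_pos hστ)).le hs
  have h1 := mul_le_mul_of_nonneg_left (hρpow ((min_le_left _ _).trans (min_le_left ση σg))) hCη.le
  have h2 := mul_le_mul_of_nonneg_left (hρpow ((min_le_left _ _).trans (min_le_right ση σg))) hCg.le
  have h3 : δ ≤ ρ ^ min (min ση σg) (στ / 2) := hρpow (min_le_right _ _)
  have hminε : min ε₁ 1 ≤ ε₁ := min_le_left _ _
  have hX : 2 * ε₁ + ((3 * Cτ' + 3) * δ + 15 * Cτ' * δ) ≤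
      (2 * (3 * Cη + 12 * Cg) + (18 * (Cτ / (4 * Real.pi ^ 2)) + 3)) * ρ ^ min (min ση σg) (στ / 2) := by
    rw [hε₁_def, ← hCτ'_def]
    have h4 := mul_le_mul_of_nonneg_left h3 (show (0:ℝ) ≤ 18 * Cτ' + 3 by positivity)
    linarith only [h1, h2, h4]
  have hmain : ‖Um1 0 t x‖ ^ 2 ≤ ‖Um 0 t x‖ ^ 2 + (2 * ε₁ + ((3 * Cτ' + 3) * δ + 15 * Cτ' * δ)) * D := by
    have h2ε : 2 * min ε₁ 1 * D ≤ 2 * ε₁ * D :=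
      mul_le_mul_of_nonneg_right (mul_le_mul_of_nonneg_left hminε zero_le_two) hD0
    linarith only [htc, h2ε, hcross, htail15, hA_def]
  have hXD := mul_le_mul_of_nonneg_right hX hD0
  simp only [drop]
  rw [hEu, hEv, hE0, ← hD_def]
  linarith only [hmain, hXD, hD_def]

/-- The v2′ text of `stub_oneLevelL_IW` from the two stubs of this file (how registry v3 will PROVE `stub_oneLevelL_IW`:
`oneLevelL_IW_of_piecesL stub_windowPropagatorL stub_windowDefectL`). -/
theorem oneLevelL_IW_of_stubs : ∀ k (W : Literature.Analysis.FluidPDE.LatticeShear.LatticeWord k) (M : ℝ) (hM : 0 < M) (c : ℝ), 0 < c →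
    ∀ (Φ : ℝ → Torus.Visc4 (Fin 3) → Torus.Visc4 (Fin 3)) (lo hi Λ β σ C ν₀ K Cf νf Kf : ℝ),
      0 < lo → lo ≤ 1 → 1 ≤ hi → 1 < Λ → 0 ≤ β →
      0 < σ → 0 ≤ C → 0 < ν₀ → 0 < K → SlowVectorClauseF W M hM c Φ lo hi Λ β σ C ν₀ K →
      0 ≤ Cf → 0 < νf → 0 < Kf → CellEnergyClausesW W M hM c lo hi Λ β Cf νf Kf →
      ∃ ν₁ > (0:ℝ), ∃ K₁ > (0:ℝ), ∃ Λ₀ : ℕ, ∃ θ₀ > (0:ℝ), ∃ C₁ > (0:ℝ), ∃ σ₁ > (0:ℝ),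
        ∀ E : Literature.Analysis.FluidPDE.LatticeShear.LagrangianLatticeCarrier k, E.design = W.stretch M hM → E.gain = c → E.nu0 = ν₁ → E.K = K₁ → E.LPermissible → E.Regular → (∀ m, Λ₀ * E.N m ≤ E.N (m + 1)) → (∀ m, E.N m ^ 2 ≤ E.N (m + 1)) → (∀ m, E.cellVisc (m + 1) * ((E.N (m + 1) : ℝ) / E.N m) ^ (1 / 4 : ℝ) ≤ 1) → (∀ m, E.K * ((E.N (m + 1) : ℝ) / E.N m) ^ (1 / 4 : ℝ) ≤ ((E.N (m + 1) : ℝ) / E.N m) * E.cellVisc (m + 1)) → (∀ m, E.θ (m + 1) * ((E.N (m + 1) : ℝ) / E.N m) ^ (1 / 16 : ℝ) ≤ θ₀) → (∀ m, ((E.N (m + 1) : ℝ) / E.N m) ^ (1 / 16 : ℝ) * E.physPeriod (m + 1) ≤ E.refresh (m + 1)) →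
        ∀ R : ℝ≥0, ∃ mstar : ℕ, ∀ m, mstar ≤ m →
          ∀ S : Torus.Visc4 (Fin 3), Torus.OddSmall S β → Torus.NearIso S lo hi →
            Torus.OddSmall (Φ (E.cellVisc (m + 1)) S) β → Torus.NearIso (Φ (E.cellVisc (m + 1)) S) lo hi →
          ∀ (w₀ : VF), IsDatum w₀ → InClass R w₀ →
          ∀ u v : ℝ → VF, TSol E (m + 1) (E.kbar (m + 1) • S) w₀ u →
            TSol E m (E.kbar m • renormStep (Φ (E.cellVisc (m + 1))) (E.gain / E.cellVisc (m + 1) ^ 2) S) w₀ v →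
            ∀ᵐ t ∂(volume.restrict (Ioo (1/2 : ℝ) 1)),
              (1 - C₁ * ((E.N m : ℝ) / E.N (m + 1)) ^ σ₁) * drop w₀ v t ≤ drop w₀ u t :=
  oneLevelL_IW_of_piecesL stub_windowPropagatorL stub_windowDefectL

end

end Summit.AnomalousDissipation.AnomalousDissipation.Cruxes.LagrangianRenormalisationStepDesign.OneLevelSplit
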